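import Summits.BirchSwinnertonDyer.BirchSwinnertonDyer.Theorems.GenusKolyvaginAtTwoEquivariantKolyvaginExactAtTwoDualityRat
import HarnessLib

/-!
# Route `GenusKolyvaginAtTwo`, LINE 6, KEY crux Q3 (inner statement of stmt-BirchSwinnertonDyer-22137):
# the two LOCAL inputs of the deepening step — `hstrict` and `hndeg` (McCallum's Lemma 5.3 at the
# bottom level: `𝓛_v = {0, c_v}` pairs non-trivially with every class outside `𝓛_v`) (helper, PROVED;
# seat `bsd-line-gk2-p2` g11)

The deepening step (`Literature/…/HeegnerPointsKolyvaginVisibleDescentDeepeningProofs`, p640533/p641249: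
McCallum Prop. 5.2 for `r = 1`, transfer form) has three pairing inputs: `hrec` (two-place reciprocity —
`…ReciprocityPair`, p641079), and the two local statements proved here over any number field `K`, at a finite
place `v ∤ p`, level `q = p^k`, for the Weil cup product `(a_v ∪ₑ c_v)` of localisations:

* `cupProduct_localization_eq_zero_of_mem_torsionLocalKer` (`hstrict`) — **`a_v = 0 ⟹ a_v ∪ c_v = 0`**;
* `cupProduct_localization_ne_zero_of_not_mem_of_mem` (`hndeg`) — if **`#E(K_v)[q] = p`** (so `𝓛_v ≅ ℤ/p`;
  at `2`: `q = 2` at a Gross–Kolyvagin prime, `E(ℚ_ℓ)[2] ≅ ℤ/2`), `a` NOT Selmer at `v`, `c` Selmer at `v` with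
  `c_v ≠ 0`: **`a_v ∪ c_v ≠ 0`** — `𝓛_v^⊥ = 𝓛_v` (`…LocalDualityPerfect`, Tate local duality off `p`, PROVED)
  and McCallum's "orders multiply" count (`pow_smul_eq_zero_of_character_of_card` with `M = 1`, `a = 0`).

Helper (`--supports` 22137), closes nothing; THEOREMS ONLY, 0 sorry, standard axioms. BSD is not proved by this.

References: [McCallumLMS1991] §5 Lemma 5.3, proof of Prop. 5.2 ((12)–(13)); [MilneADT2006] I Cor. 3.4,
Lemma 3.3; [PoonenRains2012] Prop. 4.10.
-/

set_option autoImplicit false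
set_option linter.dupNamespace false -- tree convention: `Summit.BirchSwinnertonDyer.BirchSwinnertonDyer.Theorems` (summit = sub-problem)

noncomputable section

open scoped Classical Pointwise

universe u

namespace Summit.BirchSwinnertonDyer.BirchSwinnertonDyer.Theorems.GenusExact.FrobeniusCriterion

open WeierstrassCurve NumberField IsDedekindDomain Field
open Literature.NumberTheory.EllipticCurves Literature.NumberTheory.GaloisRepresentations
open Literature.NumberTheory.GaloisCohomology
open Literature.NumberTheory.GaloisRepresentations.DiscreteGaloisModule (mu MuCarrier)
open Summit.BirchSwinnertonDyer.Rank1Residual.X11b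

variable {K : Type u} [Field K] [NumberField K] (W : WeierstrassCurve K) [W.IsElliptic]

/-- **`hstrict`: a class vanishing at `v` pairs to zero at `v`.** For `a, c ∈ H¹(K, E[q])`, `q ≠ 0`, a
finite place `v` and any Weil-type pairing `e` on `E[q]`: `a ∈ torsionLocalKer_v` (i.e. `a_v = 0`) implies
`a_v ∪ₑ c_v = 0` in `H²(K_v, μ_q)`. [cite: McCallumLMS1991, §3 (3) and §5 proof of Prop. 5.2] -/
theorem cupProduct_localization_eq_zero_of_mem_torsionLocalKer
    {q : ℕ} [NeZero q] (e : geomTorsion W q → geomTorsion W q → AlgebraicClosure K)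
    (hμ : ∀ S T, e S T ^ q = 1) (hadd₁ : ∀ S₁ S₂ T, e (S₁ + S₂) T = e S₁ T * e S₂ T)
    (hadd₂ : ∀ S T₁ T₂, e S (T₁ + T₂) = e S T₁ * e S T₂)
    (hgal : ∀ (σ : absoluteGaloisGroup K) (S T : geomTorsion W q), σ • e S T = e (σ • S) (σ • T))
    (v : HeightOneSpectrum (𝓞 K)) {a : galH1Torsion W (q : ℤ)}
    (ha : a ∈ W.torsionLocalKer (v.adicCompletion K) (q : ℤ)) (c : galH1Torsion W (q : ℤ)) :
    haveI := absoluteGaloisGroup_compactSpace (v.adicCompletion K)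
    ((weilContPairing W q e hμ hadd₁ hadd₂ hgal).restrict
      (absGaloisRestrict K (v.adicCompletion K))).cupProduct
        (galoisCohomology.localization (W.torsionGaloisModule ((q : ℕ) : ℤ)) (Sum.inr v) 1 a)
        (galoisCohomology.localization (W.torsionGaloisModule ((q : ℕ) : ℤ)) (Sum.inr v) 1 c) = 0 := by
  have _hΓc : ∀ (L : Type u) [Field L], CompactSpace (absoluteGaloisGroup L) :=
    fun L _ => absoluteGaloisGroup_compactSpace L
  haveI hK0 : CharZero (v.adicCompletion K) := charZero_adicCompletion v
  set loc := galoisCohomology.localization (W.torsionGaloisModule ((q : ℕ) : ℤ)) (Sum.inr v) 1 with hloc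
  set cup := ((weilContPairing W q e hμ hadd₁ hadd₂ hgal).restrict
      (absGaloisRestrict K (v.adicCompletion K))).cupProduct with hcup
  have ha0 : loc a = 0 := (mem_torsionLocalKer_iff_res_eq_zero W (v.adicCompletion K) (NeZero.ne q) a).mp ha
  change cup (loc a) (loc c) = 0
  rw [ha0]
  have h2 : cup 0 (loc c) = 0 := by rw [map_zero cup, LinearMap.zero_apply]
  exact h2

/-- **`hndeg`: McCallum's Lemma 5.3 at the bottom level — a class OUTSIDE `𝓛_v` pairs non-trivially with a
non-zero class of `𝓛_v ≅ ℤ/p`.** For `E = W/K` elliptic, `p` prime, `q = p^k` (`k ≠ 0`), a finite place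
`v ∤ p` with **`#E(K_v)[q] = p`**, a non-degenerate alternating equivariant `e` on `E[q]`, and classes
`a, c ∈ H¹(K, E[q])` with `a` NOT Selmer at `v`, `c` Selmer at `v` and `c_v ≠ 0`: **`a_v ∪ₑ c_v ≠ 0`.**
(`𝓛_v` has order `#E(K_v)[q]·#(𝓞_v/q) = p`, so `𝓛_v = ℤ·c_v`; if `a_v ∪ c_v = 0` then `a_v ⊥ 𝓛_v`, hence
`a_v ∈ 𝓛_v^⊥ = 𝓛_v`, i.e. `a` Selmer at `v`.) [cite: McCallumLMS1991, §5 Lemma 5.3 and proof of Prop. 5.2 (12)]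
[cite: MilneADT2006, Ch. I Cor. 3.4, Lemma 3.3] -/
theorem cupProduct_localization_ne_zero_of_not_mem_of_mem
    {p : ℕ} (hp : p.Prime) {k : ℕ} (hk : k ≠ 0) {q : ℕ} (hq : q = p ^ k) [NeZero q]
    (e : geomTorsion W q → geomTorsion W q → AlgebraicClosure K)
    (hμ : ∀ S T, e S T ^ q = 1) (hadd₁ : ∀ S₁ S₂ T, e (S₁ + S₂) T = e S₁ T * e S₂ T)
    (hadd₂ : ∀ S T₁ T₂, e S (T₁ + T₂) = e S T₁ * e S T₂) (halt : ∀ T, e T T = 1)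
    (hnondeg : ∀ T, (∀ S, e S T = 1) → T = 0)
    (hgal : ∀ (σ : absoluteGaloisGroup K) (S T : geomTorsion W q), σ • e S T = e (σ • S) (σ • T))
    (v : HeightOneSpectrum (𝓞 K)) (hpv : (p : 𝓞 K) ∉ v.asIdeal)
    (hcard : Nat.card (nsmulAddMonoidHom q :
        (W.baseChange (v.adicCompletion K)).toAffine.Point →+ _).ker = p)
    {a c : galH1Torsion W (q : ℤ)} (ha : a ∉ selmerLocalKer W (v.adicCompletion K) (q : ℤ))
    (hc : c ∈ selmerLocalKer W (v.adicCompletion K) (q : ℤ))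
    (hc0 : c ∉ W.torsionLocalKer (v.adicCompletion K) (q : ℤ)) :
    haveI := absoluteGaloisGroup_compactSpace (v.adicCompletion K)
    ((weilContPairing W q e hμ hadd₁ hadd₂ hgal).restrict
      (absGaloisRestrict K (v.adicCompletion K))).cupProduct
        (galoisCohomology.localization (W.torsionGaloisModule ((q : ℕ) : ℤ)) (Sum.inr v) 1 a)
        (galoisCohomology.localization (W.torsionGaloisModule ((q : ℕ) : ℤ)) (Sum.inr v) 1 c) ≠ 0 := by
  have _hΓc : ∀ (L : Type u) [Field L], CompactSpace (absoluteGaloisGroup L) :=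
    fun L _ => absoluteGaloisGroup_compactSpace L
  haveI : Fact p.Prime := ⟨hp⟩
  subst hq
  haveI hK0 : CharZero (v.adicCompletion K) := charZero_adicCompletion v
  have hq0 : p ^ k ≠ 0 := NeZero.ne _
  -- local objects at `v`
  set loc := galoisCohomology.localization (W.torsionGaloisModule ((p ^ k : ℕ) : ℤ)) (Sum.inr v) 1
    with hloc
  set U := W.kummerLocalConditionAt ((p ^ k : ℕ) : ℤ) (v.adicCompletion K) with hU
  set cup := ((weilContPairing W (p ^ k) e hμ hadd₁ hadd₂ hgal).restrict
      (absGaloisRestrict K (v.adicCompletion K))).cupProduct with hcup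
  -- `#U = p`
  have hUcard : Nat.card U = p := by
    rw [hU, W.natCard_kummerLocalConditionAt_adicCompletion v hq0,
      LocalDualityOrder.natCard_quotient_span_natCast_eq_one v
        (LocalDualityOrder.natCast_pow_notMem v hpv k), mul_one, hcard]
  -- `c_v ∈ U`, `c_v ≠ 0`
  have hcU : loc c ∈ U := mem_kummerLocalConditionAt_res_of_mem_selmerLocalKer W _ _ hc
  have hc0' : loc c ≠ 0 := fun h ↦
    hc0 ((mem_torsionLocalKer_iff_res_eq_zero W (v.adicCompletion K) hq0 c).mpr h)
  -- the character `ψ = (a_v ∪ ·)`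
  set ψ : galoisCohomology ((W.torsionGaloisModule ((p ^ k : ℕ) : ℤ)).toLocal (Sum.inr v)) 1 →+
      _ := (cup (loc a)).toAddMonoidHom with hψ
  have hψapp : ∀ y, ψ y = cup (loc a) y := fun _ => rfl
  -- `ψ` does not vanish on `U`: otherwise `a_v ∈ U^⊥ = U`, i.e. `a` Selmer at `v`
  have hnot : ¬ ∀ y ∈ U, (p ^ 0) • ψ y = 0 := by
    intro hall
    apply ha
    have hmem : loc a ∈ U := by
      refine (LocalDualityOrder.forall_mem_kummerLocalConditionAt_weilCupProduct_eq_zero_iff_of_not_mem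
        v W hk hpv e hμ hadd₁ hadd₂ hgal halt hnondeg _).mp fun y hy => ?_
      have h := hall y hy
      rwa [hψapp, pow_zero, one_smul] at h
    exact mem_selmerLocalKer_of_mem_kummerLocalConditionAt_res W _ _ hmem
  -- if `a_v ∪ c_v = 0`, the counting lemma (`M = 1`, `a = 0`) gives `c_v = 0`: contradiction
  intro h0
  have hψx : ψ (loc c) = 0 := by rw [hψapp]; exact h0
  have hkill : (p ^ (1 - 1 - 0)) • loc c = 0 :=
    pow_smul_eq_zero_of_character_of_card hp (M := 1) (by rw [pow_one]; exact hUcard) ψ hnot hcU hψx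
  rw [show 1 - 1 - 0 = 0 from rfl, pow_zero, one_smul] at hkill
  exact hc0' hkill

end Summit.BirchSwinnertonDyer.BirchSwinnertonDyer.Theorems.GenusExact.FrobeniusCriterion

end
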